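import Mathlib.Analysis.SpecialFunctions.Pow.Real
import Mathlib.Algebra.Order.Chebyshev
import HarnessLib

/-!
# `NoHeavyLowerTail` (stmt-CriticalPhenomena-4575) — real-variable core of the FAN THEOREM `E ≤ 1`
# (`(P(ouv) − P(ou)P(ov))² ≤ P(ou)·P(ov)·P(uv ∧ o↮u)` on every apex-over-path graph)

Support file (prover prim-ineq-gen-8 gen 57; `--supports stmt-CriticalPhenomena-4575`; memo
run/shared/lean/prim/prim-ineq-gen-8/FINDING-gen57-EROUTE.md §0(7), §2).  No definitions, no named facts, no sorries.

The fan `o ∗ P_n` (path `x_1 … x_n` with edge weights `w_j`, apex `o` joined to `x_k` with weight `h_k = 1 − q_k`, ports `u = x_1`, `v = x_n`) is the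
family on which the three-point member `a = 2` of the lineage ((PV) diagonal, `κ² ≤ 2·P·m`) is asymptotically sharp in the `a*`-parametrisation
(gen 55).  Gen 57's exact two-cluster formula specialises on fans to (memo §2, verified in exact arithmetic against brute force)
`m = W·Q`, `π = Σ_k h_k γ_k`, `p = Σ_k h_k γ′_k`, `κ = W·Q·Σ_k h_k Γ_k = W·Q·Σ_k h_k Γ′_k`
with `W = Π_j w_j`, `Q = Π_k q_k`, `γ_k = Π_{i>k} q_i · Π_{j≥k} w_j`, `γ′_k = Π_{i<k} q_i · Π_{j<k} w_j` (so `γ_k γ′_k = W·Q/q_k ≥ W·Q`) and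
`Γ_k, Γ′_k ∈ [0,1]` (probabilities that the open run to the right/left of `x_k` carries no other apex edge).  The theorem `κ² ≤ pπ·m` (`E ≤ 1`,
stronger than (★★₂) on fans) is then the following elementary inequality, by Cauchy–Schwarz:
`(Σ h_kγ_k)(Σ h_kγ′_k) ≥ (Σ h_k √(γ_kγ′_k))² ≥ M·(Σ h_k)² ≥ M·(Σ h_kΓ_k)(Σ h_kΓ′_k)` whenever `γ_kγ′_k ≥ M ≥ 0`.
* **`fan_core`** — that inequality for arbitrary finite index types. [this work]
-/

namespace Summit.CriticalPhenomena.PercolationContinuityZ3.Theorems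

namespace APL

open Finset Real

variable {ι : Type*} [Fintype ι]

/-- **Real-variable core of the fan theorem.**  If `h, γ, γ′ ≥ 0`, `0 ≤ Γ, Γ′ ≤ 1` and `γ_k·γ′_k ≥ M ≥ 0` for every `k`, then
`M · (Σ_k h_kΓ_k) · (Σ_k h_kΓ′_k) ≤ (Σ_k h_kγ_k) · (Σ_k h_kγ′_k)`.  (On the fan with `M = W·Q = m`: `m·(κ/m)² ≤ pπ`, i.e. `κ² ≤ pπ·m`.) [this work] -/
theorem fan_core (M : ℝ) (h γ γ' Γ Γ' : ι → ℝ) (hM : 0 ≤ M) (hh : ∀ k, 0 ≤ h k)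
    (hγ : ∀ k, 0 ≤ γ k) (hγ' : ∀ k, 0 ≤ γ' k) (hΓ0 : ∀ k, 0 ≤ Γ k) (hΓ1 : ∀ k, Γ k ≤ 1) (hΓ'0 : ∀ k, 0 ≤ Γ' k) (hΓ'1 : ∀ k, Γ' k ≤ 1)
    (hprod : ∀ k, M ≤ γ k * γ' k) :
    M * (∑ k, h k * Γ k) * (∑ k, h k * Γ' k) ≤ (∑ k, h k * γ k) * (∑ k, h k * γ' k) := by
  -- Step 1: `(Σ hΓ)(Σ hΓ') ≤ (Σ h)²`
  have hS0 : 0 ≤ ∑ k, h k := sum_nonneg fun k _ => hh k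
  have hA : ∑ k, h k * Γ k ≤ ∑ k, h k := sum_le_sum fun k _ => by nlinarith [hh k, hΓ1 k]
  have hB : ∑ k, h k * Γ' k ≤ ∑ k, h k := sum_le_sum fun k _ => by nlinarith [hh k, hΓ'1 k]
  have hA0 : 0 ≤ ∑ k, h k * Γ k := sum_nonneg fun k _ => mul_nonneg (hh k) (hΓ0 k)
  have hB0 : 0 ≤ ∑ k, h k * Γ' k := sum_nonneg fun k _ => mul_nonneg (hh k) (hΓ'0 k)
  have h1 : M * (∑ k, h k * Γ k) * (∑ k, h k * Γ' k) ≤ M * (∑ k, h k) ^ 2 := by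
    have := mul_le_mul hA hB hB0 hS0
    nlinarith [this]
  -- Step 2: `M (Σ h)² ≤ (Σ h √(γγ'))²`
  have h2 : M * (∑ k, h k) ^ 2 ≤ (∑ k, h k * Real.sqrt (γ k * γ' k)) ^ 2 := by
    have hle : Real.sqrt M * ∑ k, h k ≤ ∑ k, h k * Real.sqrt (γ k * γ' k) := by
      rw [mul_sum]
      refine sum_le_sum fun k _ => ?_
      rw [mul_comm]
      exact mul_le_mul_of_nonneg_left (Real.sqrt_le_sqrt (hprod k)) (hh k)
    have hl0 : 0 ≤ Real.sqrt M * ∑ k, h k := mul_nonneg (Real.sqrt_nonneg _) hS0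
    calc M * (∑ k, h k) ^ 2 = (Real.sqrt M * ∑ k, h k) ^ 2 := by
          rw [mul_pow, Real.sq_sqrt hM]
      _ ≤ (∑ k, h k * Real.sqrt (γ k * γ' k)) ^ 2 := pow_le_pow_left₀ hl0 hle 2
  -- Step 3: Cauchy–Schwarz `(Σ h√(γγ'))² ≤ (Σ hγ)(Σ hγ')`
  have h3 : (∑ k, h k * Real.sqrt (γ k * γ' k)) ^ 2 ≤ (∑ k, h k * γ k) * (∑ k, h k * γ' k) := by
    have hcs := sum_mul_sq_le_sq_mul_sq (univ : Finset ι) (fun k => Real.sqrt (h k * γ k)) (fun k => Real.sqrt (h k * γ' k))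
    have e1 : ∀ k, Real.sqrt (h k * γ k) * Real.sqrt (h k * γ' k) = h k * Real.sqrt (γ k * γ' k) := by
      intro k
      rw [← Real.sqrt_mul (mul_nonneg (hh k) (hγ k)), show h k * γ k * (h k * γ' k) = (h k) ^ 2 * (γ k * γ' k) by ring,
        Real.sqrt_mul (sq_nonneg _), Real.sqrt_sq (hh k)]
    have e2 : ∀ k, Real.sqrt (h k * γ k) ^ 2 = h k * γ k := fun k => Real.sq_sqrt (mul_nonneg (hh k) (hγ k))
    have e3 : ∀ k, Real.sqrt (h k * γ' k) ^ 2 = h k * γ' k := fun k => Real.sq_sqrt (mul_nonneg (hh k) (hγ' k))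
    simp only [e1, e2, e3] at hcs
    exact hcs
  exact h1.trans (h2.trans h3)

end APL

end Summit.CriticalPhenomena.PercolationContinuityZ3.Theorems
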